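import Summits.HodgeConjecture.HodgeConjecture.Theorems.MarkmanPartnerTransportLowPicardRMPartneredLossless
import Summits.HodgeConjecture.HodgeConjecture.Theorems.MarkmanPartnerTransportLowPicardRMKappaTable
import Summits.HodgeConjecture.HodgeConjecture.Theorems.MarkmanPartnerTransportLowPicardRMSectors
import Summits.HodgeConjecture.HodgeConjecture.Theorems.MarkmanPartnerTransportPartnerOfMinusTwoClass

/-!
# Route MarkmanPartnerTransport · crux #5 `LowPicardRealMultiplication` (stmt-HodgeConjecture-19653) —
# «CRUX-5 LEDGER BY NAME»: the crux as an explicit finite conjunction of K3 one-cycle problems and orphan κ-problems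

Cell hodge-nonav, chapter ROUTE-P1AL; planner p1 g40 ASSIGN (J) (2026-08-28T19:04Z); prover seat hodge-nonav-20241-p1
(gen 16). Leaf (imports the route file through `…LowPicardRMSectors` ∕ `…PartneredLossless`);
`--supports stmt-HodgeConjecture-19653` helper.

* `OrphanKappaPowLt[ρ, d]` — on the members of the cell `(ρ, d)` WITHOUT a K3 partner (no `(S, η, p, x, g)` with the
  route's K3 marking and (g1), (g2), (g5)), the `d − 1` kappa classes `κ_{θᵏ}` (`1 ≤ k < d`) of every `θ` carrying the
  `RMgen` data are algebraic;
* `cellHC_iff_partneredOneCycleK3_and_orphanKappaPowLt (ρ d)` — **`CellHC[ρ, d] ↔ PartneredOneCycleK3[ρ, d] ∧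
  OrphanKappaPowLt[ρ, d]`**: the partnered part by «PARTNERED LOSSLESS IFF» (`hodgeConjectureFor_iff_oneCycleK3_of_partner`),
  the orphan part by «KAPPA-IFF-SHARP» (`hodgeConjectureFor_iff_kappaClass_pow_lt_mem_algebraicClasses`), classical case
  split on the existence of a partner;
* **`lowPicardRealMultiplication_iff_ledger`** — crux #5 BY NAME ⟺ the explicit conjunction over its six cells
  (`lowPicardRealMultiplication_iff_six_cells`, fact-free): `CellKappaPowLt[1, 2]` (the orphan cell: ONE class `κ_θ`
  per member — ALL-ORPHAN form, `cellHC_iff_cellKappaPowLt`) and, for `(2,3), (2,7), (3,2), (3,4), (3,5)`,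
  `PartneredOneCycleK3[ρ, d] ∧ OrphanKappaPowLt[ρ, d]`.

So by name: «stmt-19653 ⟺ five K3 one-cycle problems (one cycle-induced endomorphism of `(2,0)`-eigenvalue degree `d` on
every K3 partner) + the orphan κ-problems (the `d − 1` classes `κ_θ, …, κ_{θ^{d−1}}` on every partner-less member of
`(1,2), (2,3), (2,7), (3,2), (3,4), (3,5)`)». ORPHANS ARE GENUINE at `ρ(X) ∈ {2, 3}` as well: a partner exists iff
`T(X)_ℚ` (rank `23 − ρ ≥ 20`) embeds in `Λ_{K3} ⊗ ℚ`, a local (Hasse-invariant) condition on `T(X)_ℚ ⊕ ⟨a⟩ ≅ Λ_{K3,ℚ}`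
for `ρ = 3` and a global rational one for `ρ = 2` (route header); the tree's partner-existence theorem (support
`PartnerExistence`, `ρ(X) ≥ 4`) does not reach these cells and is NOT used here, so the `(3, d)` orphan conjuncts are
kept. CONDITIONAL on {Beauville incidence, Beauville blow-up, O'Grady, Markman lift, Markman isometry-algebraic, Voisin
cup, Huybrechts marking, Verbitsky–Guan, Charles–Markman}, all displayed; no definition, no sorry, no new named fact.
Credits nothing: no conjunct is proved here; the crux and HC stay open.

References: E. Markman, Compos. Math. 160 (2024) Thm. 1.1, 1.4; F. Charles, E. Markman, Compos. Math. 149 (2013) Thm. 1.1;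
K. O'Grady, Commun. Contemp. Math. 10 (2008) §3; B. van Geemen, M. Schütt, Forum Math. Sigma 13 (2025) e2, §4.8; D.
Huybrechts, *Lectures on K3 Surfaces*, Ch. 14 (lattice embeddings); Yu. G. Zarhin, J. reine angew. Math. 341 (1983) Thm. 1.5.1.
-/

noncomputable section

set_option linter.dupNamespace false

open scoped Matrix
open Module CategoryTheory MonoidalCategory Polynomial
open Literature.AlgebraicTopology.SingularHomology Literature.Geometry.Kaehler
open Literature.AlgebraicGeometry Literature.AlgebraicGeometry.Motives Literature.AlgebraicGeometry.HodgeTheory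
open Literature.AlgebraicGeometry.Hyperkaehler Literature.AlgebraicGeometry.Surfaces
open Literature.AlgebraicGeometry.HilbertScheme
open Summit.HodgeConjecture.HodgeConjecture.Theorems.NikulinTwinTransport
open Summit.HodgeConjecture.HodgeConjecture.Theorems.MarkmanPartnerTransport.BBFPositivity

namespace Summit.HodgeConjecture.HodgeConjecture.Theorems.MarkmanPartnerTransport.PartnerLattice

/-- `MarkedK3Sq[X, φ, P, z]`: VERBATIM the `let MarkedK3Sq := …` binder of the route declarations of
MarkmanPartnerTransport (clauses (m1)–(m6)). Local notation only. -/
local notation3 (prettyPrint := false) "MarkedK3Sq[" X ", " φ ", " P ", " z "]" =>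
  (((IsIntegralClass P ∧ ∀ Q : complexBetti X (2 * 4), IsIntegralClass Q → ∃ n : ℤ, Q = n • P) ∧
    (∀ c : complexBetti X 2, IsIntegralClass c ↔ ∃ v : K3HilbertIndex → ℤ, φ c = fun i => (v i : ℂ)) ∧
    (∀ a : complexBetti X 2, cupPowTwo a 4 = ((3 : ℂ) * (k3HilbertForm 2 (φ a) (φ a)) ^ 2) • P) ∧
    (IsOfHodgeType 4 X 2 2 0 (LinearEquiv.symm φ z) ∧
      ∀ τ : complexBetti X 2, IsOfHodgeType 4 X 2 2 0 τ → ∃ t : ℂ, τ = t • LinearEquiv.symm φ z) ∧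
    (∀ c : complexBetti X 2, IsOfHodgeType 4 X 2 1 1 c ↔
      (k3HilbertForm 2 (φ c) z = 0 ∧ k3HilbertForm 2 (φ c) (star z) = 0)) ∧
    (k3HilbertForm 2 z z = 0 ∧ 0 < (k3HilbertForm 2 (star z) z).re)))

/-- `SpIso[X, φ]`: VERBATIM the `let SpannedByIsometries := …` binder of the route declarations (with
`IsBBFTransc` unfolded). Local notation only. -/
local notation3 (prettyPrint := false) "SpIso[" X ", " φ "]" =>
  (∀ f : complexBetti X 2 →ₗ[ℂ] complexBetti X 2, (∀ y, IsRationalClass y → IsRationalClass (f y)) →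
    (∀ (i j : ℕ) y, IsOfHodgeType 4 X 2 i j y → IsOfHodgeType 4 X 2 i j (f y)) →
    (∀ d : complexBetti X 2, d ∈ algebraicClasses X 1 → f d = 0) →
    (∀ y : complexBetti X 2, ∀ d : complexBetti X 2, d ∈ algebraicClasses X 1 →
      k3HilbertForm 2 (φ (f y)) (φ d) = 0) →
    ∃ (k : ℕ) (c : Fin k → ℚ) (g : Fin k → (complexBetti X 2 →ₗ[ℂ] complexBetti X 2)),
      (∀ i, Function.Bijective (g i) ∧ (∀ y, IsRationalClass y → IsRationalClass (g i y)) ∧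
        (∀ (a b : ℕ) y, IsOfHodgeType 4 X 2 a b y → IsOfHodgeType 4 X 2 a b (g i y)) ∧
        (∀ a b, k3HilbertForm 2 (φ (g i a)) (φ (g i b)) = k3HilbertForm 2 (φ a) (φ b))) ∧
      ∀ y : complexBetti X 2, (∀ d : complexBetti X 2, d ∈ algebraicClasses X 1 →
        k3HilbertForm 2 (φ y) (φ d) = 0) → f y = ∑ i : Fin k, ((c i : ℂ) • g i y))

/-- `RMgen[X, φ, z, d]` («RMgen» data, the `RMGenData` of Sketch P1AK-CELLS with self-adjointness added): a
rational, type-preserving, `q`-self-adjoint endomorphism `θ` of `H²(X(ℂ); ℂ)` with `θ σ = ev · σ`, `ev` real,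
`deg minpoly_ℚ(ev) = d`, `d · n + ρ(X) = 23` for some `n ≥ 3`, and GEN: every rational type-preserving endomorphism
is `Σ_{i<d} cᵢ θⁱ` (`cᵢ ∈ ℚ`) on `T(X)_ℂ = {y : q(φ y, φ N¹(X)) = 0}`. Local notation only. -/
local notation3 (prettyPrint := false) "RMgen[" X ", " φ ", " z ", " d "]" =>
  (∃ θ : complexBetti X 2 →ₗ[ℂ] complexBetti X 2, (∀ y, IsRationalClass y → IsRationalClass (θ y)) ∧
    (∀ (i j : ℕ) y, IsOfHodgeType 4 X 2 i j y → IsOfHodgeType 4 X 2 i j (θ y)) ∧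
    (∀ y w : complexBetti X 2, k3HilbertForm 2 (φ (θ y)) (φ w) = k3HilbertForm 2 (φ y) (φ (θ w))) ∧
    ∃ ev : ℂ, θ (LinearEquiv.symm φ z) = ev • LinearEquiv.symm φ z ∧ ev.im = 0 ∧
      (minpoly ℚ ev).natDegree = d ∧
      (∃ n : ℕ, 3 ≤ n ∧ d * n + Module.finrank ℂ ↥(algebraicClasses X 1) = 23) ∧
      ∀ f : complexBetti X 2 →ₗ[ℂ] complexBetti X 2, (∀ y, IsRationalClass y → IsRationalClass (f y)) →
        (∀ (i j : ℕ) y, IsOfHodgeType 4 X 2 i j y → IsOfHodgeType 4 X 2 i j (f y)) →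
        ∃ c : Fin d → ℚ, ∀ y : complexBetti X 2,
          (∀ a : complexBetti X 2, a ∈ algebraicClasses X 1 → k3HilbertForm 2 (φ y) (φ a) = 0) →
            f y = ∑ i : Fin d, ((c i : ℂ) • (θ ^ (i : ℕ)) y))

/-- `Kap[φ, g] = Σ_{ij} (G⁻¹)_{ij} · φ⁻¹eᵢ ∪ g(φ⁻¹eⱼ) ∈ H⁴(X(ℂ); ℂ)`, the kappa class of an endomorphism `g`
of `H²(X(ℂ); ℂ)` (VERBATIM `…K3Sq2TypeHodgeGraphClassesGeneral`). Local notation only. -/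
local notation3 (prettyPrint := false) "Kap[" φ ", " g "]" =>
  (∑ i : K3HilbertIndex, ∑ j : K3HilbertIndex,
    (((k3HilbertGram 2).map (Int.cast : ℤ → ℂ))⁻¹ i j) •
      cupProduct (rfl : 2 + 2 = 2 * 2) ((LinearEquiv.symm φ) (Pi.single i 1))
        (g ((LinearEquiv.symm φ) (Pi.single j 1))))

/-- `CellHC[ρ, d]`: **HC⁴ on the cell `(ρ(X), [E:ℚ]) = (ρ, d)`** — for every marked smooth projective `K3^{[2]}`-type
`(X, φ, P, z)` with `¬ SpannedByIsometries`, `ρ(X) = ρ` and `RMgen[X, φ, z, d]` (the `InCell`/`CellHC` of Sketch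
P1AK-CELLS, curried), `HodgeConjectureFor 4 X`. Local notation only. -/
local notation3 (prettyPrint := false) "CellHC[" ρ ", " d "]" =>
  (∀ (X : SchemeOver ℂ), IsSmoothProjective 4 X → IsOfK3HilbertSquareType X →
    ∀ (φ : complexBetti X 2 ≃ₗ[ℂ] (K3HilbertIndex → ℂ)) (P : complexBetti X (2 * 4)) (z : K3HilbertIndex → ℂ),
      MarkedK3Sq[X, φ, P, z] → ¬ SpIso[X, φ] → Module.finrank ℂ ↥(algebraicClasses X 1) = ρ →
        RMgen[X, φ, z, d] → HodgeConjectureFor 4 X)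

/-- `CellKappaPowLt[ρ, d]`: **the `d − 1` kappa classes `κ_{θᵏ}`, `1 ≤ k < d`, are algebraic on the cell `(ρ, d)`**
— for every marked smooth projective `K3^{[2]}`-type `(X, φ, P, z)` with `¬ SpannedByIsometries`, `ρ(X) = ρ`, and every
`θ` carrying the data of `RMgen[X, φ, z, d]`. Local notation only. -/
local notation3 (prettyPrint := false) "CellKappaPowLt[" ρ ", " d "]" =>
  (∀ (X : SchemeOver ℂ), IsSmoothProjective 4 X → IsOfK3HilbertSquareType X →
    ∀ (φ : complexBetti X 2 ≃ₗ[ℂ] (K3HilbertIndex → ℂ)) (P : complexBetti X (2 * 4)) (z : K3HilbertIndex → ℂ),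
      MarkedK3Sq[X, φ, P, z] → ¬ SpIso[X, φ] → Module.finrank ℂ ↥(algebraicClasses X 1) = ρ →
        ∀ θ : complexBetti X 2 →ₗ[ℂ] complexBetti X 2, (∀ y, IsRationalClass y → IsRationalClass (θ y)) →
          (∀ (i j : ℕ) y, IsOfHodgeType 4 X 2 i j y → IsOfHodgeType 4 X 2 i j (θ y)) →
          (∀ y w : complexBetti X 2, k3HilbertForm 2 (φ (θ y)) (φ w) = k3HilbertForm 2 (φ y) (φ (θ w))) →
          (∃ ev : ℂ, θ (LinearEquiv.symm φ z) = ev • LinearEquiv.symm φ z ∧ ev.im = 0 ∧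
            (minpoly ℚ ev).natDegree = d ∧
            (∃ n : ℕ, 3 ≤ n ∧ d * n + Module.finrank ℂ ↥(algebraicClasses X 1) = 23) ∧
            ∀ f : complexBetti X 2 →ₗ[ℂ] complexBetti X 2, (∀ y, IsRationalClass y → IsRationalClass (f y)) →
              (∀ (i j : ℕ) y, IsOfHodgeType 4 X 2 i j y → IsOfHodgeType 4 X 2 i j (f y)) →
              ∃ c : Fin d → ℚ, ∀ y : complexBetti X 2,
                (∀ a : complexBetti X 2, a ∈ algebraicClasses X 1 → k3HilbertForm 2 (φ y) (φ a) = 0) →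
                  f y = ∑ i : Fin d, ((c i : ℂ) • (θ ^ (i : ℕ)) y)) →
          ∀ k : ℕ, 1 ≤ k → k < d → Kap[φ, θ ^ k] ∈ algebraicClasses X 2)

/-- `MarkedK3[S, η, p, x]`: VERBATIM the `let MarkedK3 := …` binder of the route declarations (`p ≠ 0`, the six
marking clauses, the projective period point). Local notation only. -/
local notation3 (prettyPrint := false) "MarkedK3[" S ", " η ", " p ", " x "]" =>
  (p ≠ 0 ∧ (IsIntegralClass p ∧
    (∀ q : complexBetti S (2 * 2), IsIntegralClass q → ∃ n : ℤ, q = n • p) ∧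
    (∀ c : complexBetti S (2 * 1), IsIntegralClass c ↔ ∃ v : K3Index → ℤ, η c = fun i => (v i : ℂ)) ∧
    (∀ a b : complexBetti S (2 * 1),
      cupProduct (rfl : 2 * 1 + 2 * 1 = 2 * 2) a b = k3Form (η a) (η b) • p) ∧
    IsOfHodgeType 2 S (2 * 1) 2 0 (LinearEquiv.symm η x) ∧
    (∀ τ : complexBetti S (2 * 1), IsOfHodgeType 2 S (2 * 1) 2 0 τ →
      ∃ t : ℂ, τ = t • LinearEquiv.symm η x)) ∧
    (k3Form x x = 0 ∧ 0 < (k3Form (star x) x).re ∧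
      ∃ u : K3Index → ℤ, k3Form (fun i => (u i : ℂ)) x = 0 ∧ 0 < ∑ i, ∑ j, u i * k3Gram i j * u j))

/-- `Partner[X, φ, S, η, g]`: clauses (g1), (g2), (g5) of the route's `IsK3Partner` datum — `g : H²(S) → H²(X)`
rational, type-preserving, isometric on cup-transcendental classes (the clauses `partnerTransport_explicit` uses).
Local notation only. -/
local notation3 (prettyPrint := false) "Partner[" X ", " φ ", " S ", " η ", " g "]" =>
  ((∀ a, IsRationalClass a → IsRationalClass (g a)) ∧
    (∀ (i j : ℕ) a, IsOfHodgeType 2 S (2 * 1) i j a → IsOfHodgeType 4 X 2 i j (g a)) ∧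
    (∀ a b, (∀ d ∈ algebraicClasses S 1, cupProduct (rfl : 2 * 1 + 2 * 1 = 2 * 2) a d = 0) →
      (∀ d ∈ algebraicClasses S 1, cupProduct (rfl : 2 * 1 + 2 * 1 = 2 * 2) b d = 0) →
      k3HilbertForm 2 (φ (g a)) (φ (g b)) = k3Form (η a) (η b)))

/-- `OneCycleK3[S, hS, d]`: ONE cycle-induced transcendental endomorphism of the K3 surface `S` (rational,
type-preserving, kills `N¹`, image `⊥ N¹`, induced by an algebraic class on `S × S`) whose `(2,0)`-eigenvalue has
minimal polynomial of degree `d`. Local notation only. -/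
local notation3 (prettyPrint := false) "OneCycleK3[" S ", " hS ", " d "]" =>
  (∃ t : complexBetti S (2 * 1) →ₗ[ℂ] complexBetti S (2 * 1),
    IsCycleInducedTranscendentalEndomorphism S (IsK3Surface.isSmoothProjective hS) t ∧
    ∃ (σ₁ : complexBetti S (2 * 1)) (ev : ℂ), IsOfHodgeType 2 S (2 * 1) 2 0 σ₁ ∧ σ₁ ≠ 0 ∧
      t σ₁ = ev • σ₁ ∧ (minpoly ℚ ev).natDegree = d)

/-- `PartneredOneCycleK3[ρ, d]`: **every K3 partner of a member of the cell `(ρ, d)` carries ONE cycle-induced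
transcendental endomorphism of `(2,0)`-eigenvalue degree `d`**. Local notation only. -/
local notation3 (prettyPrint := false) "PartneredOneCycleK3[" ρ ", " d "]" =>
  (∀ (X : SchemeOver ℂ), IsSmoothProjective 4 X → IsOfK3HilbertSquareType X →
    ∀ (φ : complexBetti X 2 ≃ₗ[ℂ] (K3HilbertIndex → ℂ)) (P : complexBetti X (2 * 4)) (z : K3HilbertIndex → ℂ),
      MarkedK3Sq[X, φ, P, z] → ¬ SpIso[X, φ] → Module.finrank ℂ ↥(algebraicClasses X 1) = ρ →
        RMgen[X, φ, z, d] →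
        ∀ (S : SchemeOver ℂ) (hS : IsK3Surface S) (η : complexBetti S (2 * 1) ≃ₗ[ℂ] (K3Index → ℂ))
          (p : complexBetti S (2 * 2)) (x : K3Index → ℂ) (g : complexBetti S (2 * 1) →ₗ[ℂ] complexBetti X 2),
          MarkedK3[S, η, p, x] → Partner[X, φ, S, η, g] → OneCycleK3[S, hS, d])

/-- `OrphanKappaPowLt[ρ, d]`: **on the ORPHAN members of the cell `(ρ, d)` — those WITHOUT a K3 partner `(S, η, p, x, g)`
(route K3 marking, (g1), (g2), (g5)) — the `d − 1` kappa classes `κ_{θᵏ}`, `1 ≤ k < d`, of every `θ` carrying the `RMgen`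
data are algebraic**. Local notation only. -/
local notation3 (prettyPrint := false) "OrphanKappaPowLt[" ρ ", " d "]" =>
  (∀ (X : SchemeOver ℂ), IsSmoothProjective 4 X → IsOfK3HilbertSquareType X →
    ∀ (φ : complexBetti X 2 ≃ₗ[ℂ] (K3HilbertIndex → ℂ)) (P : complexBetti X (2 * 4)) (z : K3HilbertIndex → ℂ),
      MarkedK3Sq[X, φ, P, z] → ¬ SpIso[X, φ] → Module.finrank ℂ ↥(algebraicClasses X 1) = ρ →
        (¬ ∃ (S : SchemeOver ℂ) (_ : IsK3Surface S) (η : complexBetti S (2 * 1) ≃ₗ[ℂ] (K3Index → ℂ))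
            (p : complexBetti S (2 * 2)) (x : K3Index → ℂ) (g : complexBetti S (2 * 1) →ₗ[ℂ] complexBetti X 2),
            MarkedK3[S, η, p, x] ∧ Partner[X, φ, S, η, g]) →
        ∀ θ : complexBetti X 2 →ₗ[ℂ] complexBetti X 2, (∀ y, IsRationalClass y → IsRationalClass (θ y)) →
          (∀ (i j : ℕ) y, IsOfHodgeType 4 X 2 i j y → IsOfHodgeType 4 X 2 i j (θ y)) →
          (∀ y w : complexBetti X 2, k3HilbertForm 2 (φ (θ y)) (φ w) = k3HilbertForm 2 (φ y) (φ (θ w))) →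
          (∃ ev : ℂ, θ (LinearEquiv.symm φ z) = ev • LinearEquiv.symm φ z ∧ ev.im = 0 ∧
            (minpoly ℚ ev).natDegree = d ∧
            (∃ n : ℕ, 3 ≤ n ∧ d * n + Module.finrank ℂ ↥(algebraicClasses X 1) = 23) ∧
            ∀ f : complexBetti X 2 →ₗ[ℂ] complexBetti X 2, (∀ y, IsRationalClass y → IsRationalClass (f y)) →
              (∀ (i j : ℕ) y, IsOfHodgeType 4 X 2 i j y → IsOfHodgeType 4 X 2 i j (f y)) →
              ∃ c : Fin d → ℚ, ∀ y : complexBetti X 2,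
                (∀ a : complexBetti X 2, a ∈ algebraicClasses X 1 → k3HilbertForm 2 (φ y) (φ a) = 0) →
                  f y = ∑ i : Fin d, ((c i : ℂ) • (θ ^ (i : ℕ)) y)) →
          ∀ k : ℕ, 1 ≤ k → k < d → Kap[φ, θ ^ k] ∈ algebraicClasses X 2)

/-! ### A cell is its partnered one-cycle problem plus its orphan κ-problem -/

/-- **`CellHC[ρ, d] ↔ PartneredOneCycleK3[ρ, d] ∧ OrphanKappaPowLt[ρ, d]`** for every `(ρ, d)`: on a partnered member HC⁴
is EXACTLY one cycle of eigenvalue degree `d` on the partner (`hodgeConjectureFor_iff_oneCycleK3_of_partner`), on an orphan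
member EXACTLY the algebraicity of the `d − 1` classes `κ_{θᵏ}` (`hodgeConjectureFor_iff_kappaClass_pow_lt_mem_algebraicClasses`);
classical case split on the existence of a partner. Modulo the nine displayed facts. [cite: Markman2024, §1.1 Thm. 1.1 and Thm. 1.4]
[cite: CharlesMarkman2013, Thm. 1.1 (§1)] [cite: OGrady2008NumericalK3Square, §3] [cite: GeemenSchutt2023, §4.8 and Rem. 4.9] -/
theorem cellHC_iff_partneredOneCycleK3_and_orphanKappaPowLt (hBI : Beauville1983_hilbertSquare_markedIncidence)
    (hBea : Beauville1983_hilbertSquare_blowupDiagonal_surjection) (hO : OGrady2008_dualBBFClass_algebraic)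
    (hMk : Markman2024_rationalHodgeIsometry_lift_algebraic_marked) (hcup : Voisin2003_cupProduct_algebraicClasses)
    (hMkI : Markman2024_rationalHodgeIsometry_algebraic_marked) (hV : VerbitskyGuan_cohomology_K3HilbertSquareType)
    (hB : CharlesMarkman2013_lefschetzStandard_K3HilbertType) (hmark : Huybrechts_K3_marking_exists) (ρ d : ℕ) :
    CellHC[ρ, d] ↔ (PartneredOneCycleK3[ρ, d] ∧ OrphanKappaPowLt[ρ, d]) := by
  classical
  refine ⟨fun h => ⟨fun X hX hK φ P z hM hsp hρ hR S hS η p x g hMS hg => ?_,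
      fun X hX hK φ P z hM hsp hρ _ θ h1 h2 h5 hdata k _ _ => ?_⟩, fun ⟨hP, hO'⟩ X hX hK φ P z hM hsp hρ hR => ?_⟩
  · exact exists_oneCycleK3_of_partner_of_hodgeConjectureFor hBI hO hcup hMkI hV hB hX hK hM hR hS hMS hg
      (h X hX hK φ P z hM hsp hρ hR)
  · exact OrphanSR.kappaClass_mem_algebraicClasses_of_hodgeConjectureFor hX hM
      (h X hX hK φ P z hM hsp hρ ⟨θ, h1, h2, h5, hdata⟩) (θ ^ k) (isRationalClass_pow_apply θ h1 k)
      (isOfHodgeType_pow_apply θ h2 k)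
  · by_cases hpar : ∃ (S : SchemeOver ℂ) (_ : IsK3Surface S) (η : complexBetti S (2 * 1) ≃ₗ[ℂ] (K3Index → ℂ))
        (p : complexBetti S (2 * 2)) (x : K3Index → ℂ) (g : complexBetti S (2 * 1) →ₗ[ℂ] complexBetti X 2),
        MarkedK3[S, η, p, x] ∧ Partner[X, φ, S, η, g]
    · obtain ⟨S, hS, η, p, x, g, hMS, hg⟩ := hpar
      obtain ⟨t, ht, ht_ev⟩ := hP X hX hK φ P z hM hsp hρ hR S hS η p x g hMS hg
      exact hodgeConjectureFor_of_partner_of_rmGenerator_of_cycleInduced_natDegree hBI hBea hMk hcup hmark hX hK hM hR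
        hS hMS hg t ht ht_ev
    · obtain ⟨θ, h1, h2, h5, hdata⟩ := hR
      obtain ⟨ev, hev, hevim, hdeg, hn, hG⟩ := id hdata
      exact hodgeConjectureFor_of_kappaClass_pow_lt_mem_algebraicClasses hV hO hX hK hM θ h1 h2 h5 hG
        (hO' X hX hK φ P z hM hsp hρ hpar θ h1 h2 h5 hdata)

/-! ### The ledger -/

/-- **«CRUX-5 LEDGER BY NAME».** The crux `LowPicardRealMultiplication` (stmt-HodgeConjecture-19653) is EQUIVALENT to the
explicit finite conjunction over its six cells (`lowPicardRealMultiplication_iff_six_cells`, fact-free):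

* `(1,2)` — the ORPHAN cell (no projective K3 partner at `ρ(X) = 1`), ALL-ORPHAN form: on every member the ONE class `κ_θ`
  of the RM generator is algebraic (`CellKappaPowLt[1, 2]`, i.e. `κ_{θᵏ}` for `1 ≤ k < 2`);
* `(2,3), (2,7), (3,2), (3,4), (3,5)` — on every PARTNERED member, ONE cycle-induced endomorphism of `(2,0)`-eigenvalue
  degree `d` on the K3 partner (`PartneredOneCycleK3`), AND on every ORPHAN member the `d − 1` classes
  `κ_θ, …, κ_{θ^{d−1}}` algebraic (`OrphanKappaPowLt`; orphans at `ρ(X) ∈ {2, 3}` are genuine — a Hasse-type condition on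
  `T(X)_ℚ`, module docstring).

Modulo the nine displayed named facts; nothing here proves any conjunct, the crux, or HC.
[cite: Markman2024, §1.1 Thm. 1.1 and Thm. 1.4] [cite: CharlesMarkman2013, Thm. 1.1 (§1)] [cite: OGrady2008NumericalK3Square, §3]
[cite: GeemenSchutt2023, §4.8 and Rem. 4.9] [cite: Zarhin1983HodgeGroupsK3, Thm. 1.5.1] -/
theorem lowPicardRealMultiplication_iff_ledger (hBI : Beauville1983_hilbertSquare_markedIncidence)
    (hBea : Beauville1983_hilbertSquare_blowupDiagonal_surjection) (hO : OGrady2008_dualBBFClass_algebraic)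
    (hMk : Markman2024_rationalHodgeIsometry_lift_algebraic_marked) (hcup : Voisin2003_cupProduct_algebraicClasses)
    (hMkI : Markman2024_rationalHodgeIsometry_algebraic_marked) (hV : VerbitskyGuan_cohomology_K3HilbertSquareType)
    (hB : CharlesMarkman2013_lefschetzStandard_K3HilbertType) (hmark : Huybrechts_K3_marking_exists) :
    Summit.HodgeConjecture.HodgeConjecture.Theses.MarkmanPartnerTransport.LowPicardRealMultiplication ↔
      (CellKappaPowLt[1, 2] ∧
        (PartneredOneCycleK3[2, 3] ∧ OrphanKappaPowLt[2, 3]) ∧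
        (PartneredOneCycleK3[2, 7] ∧ OrphanKappaPowLt[2, 7]) ∧
        (PartneredOneCycleK3[3, 2] ∧ OrphanKappaPowLt[3, 2]) ∧
        (PartneredOneCycleK3[3, 4] ∧ OrphanKappaPowLt[3, 4]) ∧
        (PartneredOneCycleK3[3, 5] ∧ OrphanKappaPowLt[3, 5])) := by
  have hc := cellHC_iff_partneredOneCycleK3_and_orphanKappaPowLt hBI hBea hO hMk hcup hMkI hV hB hmark
  exact lowPicardRealMultiplication_iff_six_cells.trans
    (and_congr (cellHC_iff_cellKappaPowLt hV hO 1 2) (and_congr (hc 2 3) (and_congr (hc 2 7)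
      (and_congr (hc 3 2) (and_congr (hc 3 4) (hc 3 5))))))

/-! ### Appended (gen 16, (L1) «ORPHAN ⟺ NS(X)_ℚ does not represent −2», p1 g40 19:21Z) -/

/-- `RepM2[X, φ]`: `NS(X)_ℚ` represents `−2` (VERBATIM the right side of `exists_partner_iff_representsMinusTwo`). Local
notation only. -/
local notation3 (prettyPrint := false) "RepM2[" X ", " φ "]" =>
  (∃ v : K3HilbertIndex → ℚ, (LinearEquiv.symm φ) (fun i => ((v i : ℚ) : ℂ)) ∈ algebraicClasses X 1 ∧
    k3HilbertForm 2 (fun i => ((v i : ℚ) : ℂ)) (fun i => ((v i : ℚ) : ℂ)) = -2)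

/-- `OrphanKappaPowLtArith[ρ, d]`: `OrphanKappaPowLt[ρ, d]` with the orphan clause replaced by the INTRINSIC ARITHMETIC
predicate «`NS(X)_ℚ` does not represent `−2`». Local notation only. -/
local notation3 (prettyPrint := false) "OrphanKappaPowLtArith[" ρ ", " d "]" =>
  (∀ (X : SchemeOver ℂ), IsSmoothProjective 4 X → IsOfK3HilbertSquareType X →
    ∀ (φ : complexBetti X 2 ≃ₗ[ℂ] (K3HilbertIndex → ℂ)) (P : complexBetti X (2 * 4)) (z : K3HilbertIndex → ℂ),
      MarkedK3Sq[X, φ, P, z] → ¬ SpIso[X, φ] → Module.finrank ℂ ↥(algebraicClasses X 1) = ρ → ¬ RepM2[X, φ] →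
        ∀ θ : complexBetti X 2 →ₗ[ℂ] complexBetti X 2, (∀ y, IsRationalClass y → IsRationalClass (θ y)) →
          (∀ (i j : ℕ) y, IsOfHodgeType 4 X 2 i j y → IsOfHodgeType 4 X 2 i j (θ y)) →
          (∀ y w : complexBetti X 2, k3HilbertForm 2 (φ (θ y)) (φ w) = k3HilbertForm 2 (φ y) (φ (θ w))) →
          (∃ ev : ℂ, θ (LinearEquiv.symm φ z) = ev • LinearEquiv.symm φ z ∧ ev.im = 0 ∧
            (minpoly ℚ ev).natDegree = d ∧
            (∃ n : ℕ, 3 ≤ n ∧ d * n + Module.finrank ℂ ↥(algebraicClasses X 1) = 23) ∧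
            ∀ f : complexBetti X 2 →ₗ[ℂ] complexBetti X 2, (∀ y, IsRationalClass y → IsRationalClass (f y)) →
              (∀ (i j : ℕ) y, IsOfHodgeType 4 X 2 i j y → IsOfHodgeType 4 X 2 i j (f y)) →
              ∃ c : Fin d → ℚ, ∀ y : complexBetti X 2,
                (∀ a : complexBetti X 2, a ∈ algebraicClasses X 1 → k3HilbertForm 2 (φ y) (φ a) = 0) →
                  f y = ∑ i : Fin d, ((c i : ℂ) • (θ ^ (i : ℕ)) y)) →
          ∀ k : ℕ, 1 ≤ k → k < d → Kap[φ, θ ^ k] ∈ algebraicClasses X 2)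

/-- **A `K3^{[2]}`-type fourfold has a K3 partner in the sense of the ledger (route K3 marking, (g1), (g2), (g5)) iff
`NS(X)_ℚ` represents `−2`.** (⇒) the marked rational Hodge isometry `f : H²(S^{[2]}) ⥲ H²(X)`
(`exists_markedHodgeIsometry_of_partner`) carries Beauville's class `δ` (`q(δ) = −2`, algebraic) to a rational algebraic
class of square `−2`; (⇐) `exists_k3Partner_of_minusTwoClass`. Modulo {Beauville incidence, Voisin cup} (⇒),
`Huybrechts_K3_periodSurjective_projective` (⇐). [cite: Beauville1983, §6 Prop. 6, §9 Lemme 1 and Rem. 1]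
[cite: Huybrechts2016K3, Ch. 6 Thm. 3.1, Ch. 7 Thm. 4.1] [cite: Morrison1984, §1–2] -/
theorem exists_partner_iff_representsMinusTwo' (hP : Huybrechts_K3_periodSurjective_projective)
    (hBI : Beauville1983_hilbertSquare_markedIncidence) (hcup : Voisin2003_cupProduct_algebraicClasses)
    {X : SchemeOver ℂ} (hX : IsSmoothProjective 4 X) {φ : complexBetti X 2 ≃ₗ[ℂ] (K3HilbertIndex → ℂ)}
    {P : complexBetti X (2 * 4)} {z : K3HilbertIndex → ℂ} (hM : MarkedK3Sq[X, φ, P, z]) :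
    (∃ (S : SchemeOver ℂ) (_ : IsK3Surface S) (η : complexBetti S (2 * 1) ≃ₗ[ℂ] (K3Index → ℂ))
        (p : complexBetti S (2 * 2)) (x : K3Index → ℂ) (g : complexBetti S (2 * 1) →ₗ[ℂ] complexBetti X 2),
        MarkedK3[S, η, p, x] ∧ Partner[X, φ, S, η, g]) ↔ RepM2[X, φ] := by
  obtain ⟨-, hint, -⟩ := id hM
  have hμ := hasPoincareDuality_complexOrientationFamily
  constructor
  · rintro ⟨S, hS, η, p, x, g, ⟨-, hmk, hxx, hxpos, hu⟩, hg1, hg2, hg5⟩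
    obtain ⟨H, hH, Ξ, φH, PH, -, -, hMH, θ, hθ, hi⟩ := hBI complexOrientationFamily hμ S hS η p x hmk hxx hxpos hu
    obtain ⟨-, hintH, -⟩ := id hMH
    obtain ⟨f, -, hfrat, hfh, hfq⟩ := exists_markedHodgeIsometry_of_partner hcup hμ hX hM hS hmk.2.2.1 hmk.2.2.2.1
      hmk.2.2.2.2.1 hxpos hH hMH hθ hi hg1 hg2 hg5
    have hδalg : φH.symm (Sum.elim 0 1) ∈ algebraicClasses H 1 := delta_mem_algebraicClasses hH hMH
    have hδrat : IsRationalClass (φH.symm (Sum.elim 0 1)) :=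
      (isRationalClass_iff_of_markedSq hH hintH _).2
        ⟨Pi.single (Sum.inr ()) 1, by rw [LinearEquiv.apply_symm_apply, ratCast_single_inr]⟩
    obtain ⟨v, hv⟩ := (isRationalClass_iff_of_markedSq hX hint _).1 (hfrat _ hδrat)
    refine ⟨v, ?_, ?_⟩
    · rw [← hv, LinearEquiv.symm_apply_apply]
      exact map_mem_algebraicClasses_of_isRationalClass_of_oneOne hH hX f hfrat (hfh 1 1) hδalg
    · rw [← hv, hfq, LinearEquiv.apply_symm_apply, k3HilbertForm_delta_right]
      simp
  · rintro ⟨v, hv, hq⟩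
    have hrat : IsRationalClass ((LinearEquiv.symm φ) (fun i => ((v i : ℚ) : ℂ))) :=
      (isRationalClass_iff_of_markedSq hX hint _).2 ⟨v, by rw [LinearEquiv.apply_symm_apply]⟩
    obtain ⟨S, η, p, x, g, hS, hMS, ⟨hg1, hg2, -, -, hg5, -, -⟩, -⟩ := exists_k3Partner_of_minusTwoClass hP hX hM hv hrat
      (by rw [LinearEquiv.apply_symm_apply]; exact hq)
    exact ⟨S, hS, η, p, x, g, hMS, hg1, hg2, hg5⟩

/-- **ORPHAN ⟺ `NS(X)_ℚ` does not represent `−2`** (the ledger's orphan clause is an intrinsic arithmetic predicate).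
[cite: Beauville1983, §9 Rem. 1] [cite: Huybrechts2016K3, Ch. 6 Thm. 3.1] -/
theorem orphan_iff_not_representsMinusTwo (hP : Huybrechts_K3_periodSurjective_projective)
    (hBI : Beauville1983_hilbertSquare_markedIncidence) (hcup : Voisin2003_cupProduct_algebraicClasses)
    {X : SchemeOver ℂ} (hX : IsSmoothProjective 4 X) {φ : complexBetti X 2 ≃ₗ[ℂ] (K3HilbertIndex → ℂ)}
    {P : complexBetti X (2 * 4)} {z : K3HilbertIndex → ℂ} (hM : MarkedK3Sq[X, φ, P, z]) :
    (¬ ∃ (S : SchemeOver ℂ) (_ : IsK3Surface S) (η : complexBetti S (2 * 1) ≃ₗ[ℂ] (K3Index → ℂ))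
        (p : complexBetti S (2 * 2)) (x : K3Index → ℂ) (g : complexBetti S (2 * 1) →ₗ[ℂ] complexBetti X 2),
        MarkedK3[S, η, p, x] ∧ Partner[X, φ, S, η, g]) ↔ ¬ RepM2[X, φ] :=
  not_congr (exists_partner_iff_representsMinusTwo' hP hBI hcup hX hM)

/-- **The orphan conjuncts of the ledger, arithmetically: `OrphanKappaPowLt[ρ, d] ↔ OrphanKappaPowLtArith[ρ, d]`** —
«on every member of the cell whose `NS(X)_ℚ` does NOT represent `−2`, the `d − 1` classes `κ_{θᵏ}` are algebraic».
Modulo {period surjectivity, Beauville incidence, Voisin cup}. [cite: Beauville1983, §9 Rem. 1] [cite: Morrison1984, §1–2] -/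
theorem orphanKappaPowLt_iff_arith (hP : Huybrechts_K3_periodSurjective_projective)
    (hBI : Beauville1983_hilbertSquare_markedIncidence) (hcup : Voisin2003_cupProduct_algebraicClasses) (ρ d : ℕ) :
    OrphanKappaPowLt[ρ, d] ↔ OrphanKappaPowLtArith[ρ, d] := by
  refine ⟨fun h X hX hK φ P z hM hsp hρ horph => h X hX hK φ P z hM hsp hρ
      ((orphan_iff_not_representsMinusTwo hP hBI hcup hX hM).2 horph),
    fun h X hX hK φ P z hM hsp hρ horph => h X hX hK φ P z hM hsp hρ
      ((orphan_iff_not_representsMinusTwo hP hBI hcup hX hM).1 horph)⟩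

/-- **«CRUX-5 LEDGER», ARITHMETIC FORM**: the crux ⟺ `CellKappaPowLt[1, 2]` ∧ ⋀ over the five other cells of
(`PartneredOneCycleK3[ρ, d]` ∧ `OrphanKappaPowLtArith[ρ, d]`) — the orphan conjuncts read over «`NS(X)_ℚ` does not
represent `−2`» (`orphanKappaPowLt_iff_arith`). Modulo the nine facts of `lowPicardRealMultiplication_iff_ledger` and
`Huybrechts_K3_periodSurjective_projective`. [cite: Markman2024, §1.1 Thm. 1.1 and Thm. 1.4] [cite: Beauville1983, §9 Rem. 1]
[cite: Morrison1984, §1–2] [cite: CharlesMarkman2013, Thm. 1.1 (§1)] -/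
theorem lowPicardRealMultiplication_iff_ledger_arith (hP : Huybrechts_K3_periodSurjective_projective)
    (hBI : Beauville1983_hilbertSquare_markedIncidence) (hBea : Beauville1983_hilbertSquare_blowupDiagonal_surjection)
    (hO : OGrady2008_dualBBFClass_algebraic) (hMk : Markman2024_rationalHodgeIsometry_lift_algebraic_marked)
    (hcup : Voisin2003_cupProduct_algebraicClasses) (hMkI : Markman2024_rationalHodgeIsometry_algebraic_marked)
    (hV : VerbitskyGuan_cohomology_K3HilbertSquareType) (hB : CharlesMarkman2013_lefschetzStandard_K3HilbertType)
    (hmark : Huybrechts_K3_marking_exists) :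
    Summit.HodgeConjecture.HodgeConjecture.Theses.MarkmanPartnerTransport.LowPicardRealMultiplication ↔
      (CellKappaPowLt[1, 2] ∧
        (PartneredOneCycleK3[2, 3] ∧ OrphanKappaPowLtArith[2, 3]) ∧
        (PartneredOneCycleK3[2, 7] ∧ OrphanKappaPowLtArith[2, 7]) ∧
        (PartneredOneCycleK3[3, 2] ∧ OrphanKappaPowLtArith[3, 2]) ∧
        (PartneredOneCycleK3[3, 4] ∧ OrphanKappaPowLtArith[3, 4]) ∧
        (PartneredOneCycleK3[3, 5] ∧ OrphanKappaPowLtArith[3, 5])) := by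
  have hc := orphanKappaPowLt_iff_arith hP hBI hcup
  exact (lowPicardRealMultiplication_iff_ledger hBI hBea hO hMk hcup hMkI hV hB hmark).trans
    (and_congr Iff.rfl (and_congr (and_congr Iff.rfl (hc 2 3)) (and_congr (and_congr Iff.rfl (hc 2 7))
      (and_congr (and_congr Iff.rfl (hc 3 2)) (and_congr (and_congr Iff.rfl (hc 3 4)) (and_congr Iff.rfl (hc 3 5)))))))

end Summit.HodgeConjecture.HodgeConjecture.Theorems.MarkmanPartnerTransport.PartnerLattice

end
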